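import Literature.MathematicalPhysics.QuantumLattice.TorusWilsonMarkov

/-!
# Conditional independence of separated cubes under Wilson's torus measure

Stub C1 of the line `Sketch` (markov-shielding) of the crux `TemperedCurvatureMoments`
(`Summit.QuantumFields.YangMills.Theses.IsotropyFromPowerCounting.TemperedCurvatureMoments`):
the DLR/MARKOV content of the Markov shielding.

On the torus `(ℤ/L)⁴` let `Λ₁, …, Λₙ` be the sets of links based in the sup-cubes of radius
`R` around centres `c₁, …, cₙ` which are pairwise at torus distance `≥ 2R+2` in some
coordinate (`2R+1 < L`), and let `φᵢ` be bounded measurable observables reading only the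
links in `Λᵢ`.  Writing `ext` for the links outside all cubes and `extᵢ` for the links
outside the `i`-th cube, Wilson's torus measure `μ = wilsonMeasure ρ β` satisfies

* (ii) `μ[φᵢ | ext] = μ[φᵢ | extᵢ]` a.e., and
* (i)  `μ[∏ᵢ φᵢ | ext] = ∏ᵢ μ[φᵢ | ext]` a.e.

Proof (Georgii 2011, Rem. 1.24 with (2.11); Friedli–Velenik 2017, §6.3): `μ` is a DLR state
of the plaquette specification `γ` (`isGibbsMeasure_wilsonMeasure`), and the kernel average
`gᵢ := γ_{Λᵢ} φᵢ` is a version of `μ[φᵢ | 𝓕_{Λᵢᶜ}] = μ[φᵢ | extᵢ]` reading only the links of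
plaquettes touching `Λᵢ` (`stronglyMeasurable_and_ae_eq_condExp_integral_gibbsSpecOfPotential`).
The separation forces: no plaquette has links in two different cubes (the base points of the
links of a plaquette differ by `0` or `1` in every coordinate), so `gᵢ` is `𝓕_{ext}`-measurable;
the tower property gives (ii) in the sharper form `μ[φᵢ | ext] = gᵢ`, and (i) follows by
peeling off one cube at a time: `μ[φⱼ P | ext] = μ[μ[φⱼ | 𝓕_{Λⱼᶜ}] P | ext] = μ[gⱼ P | ext]
= gⱼ μ[P | ext]` for `P = ∏_{i ∈ J} φᵢ`, `j ∉ J` (pull-out: `P` is `𝓕_{Λⱼᶜ}`-measurable since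
the cubes are disjoint, `gⱼ` is `𝓕_{ext}`-measurable).

References: H.-O. Georgii, *Gibbs Measures and Phase Transitions* (2011), Rem. 1.24, (2.11);
S. Friedli, Y. Velenik, *Statistical Mechanics of Lattice Systems* (2017), §6.3.
-/

noncomputable section

namespace Summit.QuantumFields.YangMills.Theorems.TemperedCurvatureMoments.Sketch

open MeasureTheory ProbabilityTheory Filter
open Literature.MathematicalPhysics.QuantumFieldTheory Literature.MathematicalPhysics.QuantumLattice
open Literature.Probability.LatticeModels

/-! ### Torus arithmetic: links of one plaquette never lie in two separated cubes -/

/-- An element of `ZMod L` which is the cast of an integer of modulus `≤ m < L` has value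
`≤ m`, or its negation has. -/
private theorem val_le_or_val_neg_le {L : ℕ} [NeZero L] {z : ZMod L} {t : ℤ} {m : ℕ}
    (hz : z = t) (ht : |t| ≤ m) (hm : m < L) : z.val ≤ m ∨ (-z).val ≤ m := by
  subst hz
  obtain ⟨k, hk⟩ := Int.eq_nat_or_neg t
  have habs := abs_le.1 ht
  rcases hk with rfl | rfl
  · left
    have hkm : k ≤ m := by omega
    rw [Int.cast_natCast, ZMod.val_natCast, Nat.mod_eq_of_lt (by omega)]
    exact hkm
  · right
    have hkm : k ≤ m := by omega
    rw [Int.cast_neg, neg_neg, Int.cast_natCast, ZMod.val_natCast, Nat.mod_eq_of_lt (by omega)]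
    exact hkm

/-- **Arithmetic core of the cube separation** in one coordinate of the torus `ZMod L`,
`2R+1 < L`: if two coordinates `b, b'` differ by `0` or `±1` and lie in the windows of radius
`R` around `c`, `c'` respectively (`(b - c + R).val ≤ 2R`), then `c, c'` are at torus distance
`≤ 2R+1` in one of the two orientations. -/
private theorem val_sub_le_or_of_adjacent {L : ℕ} [NeZero L] {R : ℕ} (hL : 2 * R + 1 < L)
    {b b' c c' : ZMod L} (hb : b' = b ∨ b' = b + 1 ∨ b = b' + 1)
    (hc : (b - c + R).val ≤ 2 * R) (hc' : (b' - c' + R).val ≤ 2 * R) :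
    (c - c').val ≤ 2 * R + 1 ∨ (c' - c).val ≤ 2 * R + 1 := by
  obtain ⟨ε, hε, hbb⟩ : ∃ ε : ℤ, |ε| ≤ 1 ∧ b - b' = ε := by
    rcases hb with rfl | rfl | rfl
    · exact ⟨0, by simp, by simp⟩
    · exact ⟨-1, by simp, by push_cast; ring⟩
    · exact ⟨1, by simp, by push_cast; ring⟩
  have h1 : ((b - c + R).val : ZMod L) = b - c + R := ZMod.natCast_zmod_val _
  have h2 : ((b' - c' + R).val : ZMod L) = b' - c' + R := ZMod.natCast_zmod_val _
  have key : c - c' = ((ε + (b' - c' + R).val - (b - c + R).val : ℤ) : ZMod L) := by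
    push_cast
    linear_combination h1 - h2 + hbb
  have habs : |ε + (b' - c' + R).val - (b - c + R).val| ≤ ((2 * R + 1 : ℕ) : ℤ) := by
    rw [abs_le] at hε ⊢
    push_cast
    omega
  rcases val_le_or_val_neg_le key habs hL with h | h
  · exact Or.inl h
  · right
    rwa [neg_sub] at h

/-- The base point of every link of the plaquette `(y, i' < j')` is `y` or `y + e_k`: each of
its coordinates is `y ν` or `y ν + 1`. -/
private theorem apply_eq_or_of_mem_plaquette {L : ℕ} {y : Site 4 L} {i' j' : Fin 4}
    {e : Edge 4 L}
    (he : e ∈ ({(y, i'), (y.shift i', j'), (y.shift j', i'), (y, j')} : Finset (Edge 4 L)))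
    (ν : Fin 4) : e.1 ν = y ν ∨ e.1 ν = y ν + 1 := by
  have hshift : ∀ k : Fin 4, (y.shift k) ν = y ν ∨ (y.shift k) ν = y ν + 1 := fun k => by
    simp only [Literature.MathematicalPhysics.QuantumFieldTheory.Site.shift, Pi.add_apply,
      Pi.single_apply]
    split_ifs <;> simp
  simp only [Finset.mem_insert, Finset.mem_singleton] at he
  rcases he with rfl | rfl | rfl | rfl
  · exact Or.inl rfl
  · exact hshift i'
  · exact hshift j'
  · exact Or.inl rfl

/-- **No plaquette meets two separated cubes.** If two links `e₀, e` of one plaquette lie in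
the cubes `{ℓ | ∀ ν, (ℓ.1 ν - c ν + R).val ≤ 2R}` around `c` and `c'`, then `c, c'` are NOT
separated: in every coordinate one of the two torus distances is `≤ 2R+1`. -/
private theorem not_separated_of_mem_plaquette {L : ℕ} [NeZero L] {R : ℕ} (hL : 2 * R + 1 < L)
    {y : Site 4 L} {i' j' : Fin 4} {e₀ e : Edge 4 L}
    (he₀ : e₀ ∈ ({(y, i'), (y.shift i', j'), (y.shift j', i'), (y, j')} : Finset (Edge 4 L)))
    (he : e ∈ ({(y, i'), (y.shift i', j'), (y.shift j', i'), (y, j')} : Finset (Edge 4 L)))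
    {c c' : Fin 4 → ZMod L} (hc : ∀ ν, (e₀.1 ν - c ν + R).val ≤ 2 * R)
    (hc' : ∀ ν, (e.1 ν - c' ν + R).val ≤ 2 * R) (ν : Fin 4) :
    (c ν - c' ν).val ≤ 2 * R + 1 ∨ (c' ν - c ν).val ≤ 2 * R + 1 := by
  refine val_sub_le_or_of_adjacent hL ?_ (hc ν) (hc' ν)
  rcases apply_eq_or_of_mem_plaquette he₀ ν with h₀ | h₀ <;>
    rcases apply_eq_or_of_mem_plaquette he ν with h | h
  · exact Or.inl (h.trans h₀.symm)
  · exact Or.inr (Or.inl (by rw [h, h₀]))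
  · exact Or.inr (Or.inr (by rw [h, h₀]))
  · exact Or.inl (h.trans h₀.symm)

/-! ### Conditional independence of separated cubes -/

variable {G : Type} [Group G] [TopologicalSpace G] [IsTopologicalGroup G] [CompactSpace G]
  [MeasurableSpace G] [BorelSpace G]

/-- **Conditional independence of separated cubes under Wilson's torus measure**, general
torus side `L` with `2R+1 < L` and centres `cᵢ ∈ (ZMod L)⁴` (Georgii 2011, Rem. 1.24 with
(2.11); Friedli–Velenik 2017, §6.3): for bounded measurable observables `φᵢ` reading only the
links based in pairwise separated sup-cubes of radius `R`, conditionally on the links based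
outside all cubes, `μ[∏ᵢ φᵢ | ext] = ∏ᵢ μ[φᵢ | ext]` and `μ[φᵢ | ext] = μ[φᵢ | extᵢ]` a.e. -/
theorem condExp_prod_cubes_wilsonMeasure {L : ℕ} [NeZero L] (r : LatticeRep G) (β : ℝ) (R : ℕ)
    (hL : 2 * R + 1 < L) {n : ℕ} (c : Fin n → Fin 4 → ZMod L)
    (hsep : ∀ i j, i ≠ j → ∃ ν : Fin 4,
      2 * R + 2 ≤ (c i ν - c j ν).val ∧ 2 * R + 2 ≤ (c j ν - c i ν).val)
    (φ : Fin n → GaugeConfig 4 L G → ℝ) (hφm : ∀ i, Measurable (φ i))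
    (hφb : ∀ i, ∃ M : ℝ, ∀ U, |φ i U| ≤ M)
    (hφd : ∀ i, DependsOn (φ i) {ℓ : Edge 4 L | ∀ ν : Fin 4, (ℓ.1 ν - c i ν + R).val ≤ 2 * R}) :
    (wilsonMeasure (d := 4) (L := L) r.ρ β)[(fun U => ∏ i, φ i U) |
        cylinderEvents {ℓ : Edge 4 L | ∀ i : Fin n, ¬ ∀ ν : Fin 4, (ℓ.1 ν - c i ν + R).val ≤ 2 * R}]
      =ᵐ[wilsonMeasure (d := 4) (L := L) r.ρ β]
      (fun U => ∏ i, ((wilsonMeasure (d := 4) (L := L) r.ρ β)[φ i |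
        cylinderEvents {ℓ : Edge 4 L | ∀ i : Fin n,
          ¬ ∀ ν : Fin 4, (ℓ.1 ν - c i ν + R).val ≤ 2 * R}]) U) ∧
    ∀ i : Fin n,
      (wilsonMeasure (d := 4) (L := L) r.ρ β)[φ i |
        cylinderEvents {ℓ : Edge 4 L | ∀ i : Fin n, ¬ ∀ ν : Fin 4, (ℓ.1 ν - c i ν + R).val ≤ 2 * R}]
      =ᵐ[wilsonMeasure (d := 4) (L := L) r.ρ β]
      (wilsonMeasure (d := 4) (L := L) r.ρ β)[φ i |
        cylinderEvents {ℓ : Edge 4 L | ¬ ∀ ν : Fin 4, (ℓ.1 ν - c i ν + R).val ≤ 2 * R}] := by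
  classical
  haveI : SecondCountableTopology G :=
    (r.continuous.isClosedEmbedding r.injective).isEmbedding.secondCountableTopology
  haveI : T2Space G := (r.continuous.isClosedEmbedding r.injective).isEmbedding.t2Space
  set μ : Measure (GaugeConfig 4 L G) := wilsonMeasure (d := 4) (L := L) r.ρ β with hμ
  haveI : IsProbabilityMeasure μ :=
    isProbabilityMeasure_wilsonMeasure (d := 4) (L := L) r.ρ r.continuous β
  obtain ⟨Φ, supp, hΦ, hΦb, hsupp, hH, hstruct⟩ :=
    exists_plaquettePotential (d := 4) (L := L) r.ρ r.continuous
  have hGibbs : IsGibbsMeasure (gibbsSpecOfPotential (haarProbability G) Φ supp β) μ :=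
    isGibbsMeasure_wilsonMeasure r.ρ r.continuous hΦ hΦb hsupp hH β
  -- the cubes, the exterior, the volumes `Λ i`
  set cube : Fin n → Set (Edge 4 L) :=
    fun i => {ℓ | ∀ ν : Fin 4, (ℓ.1 ν - c i ν + R).val ≤ 2 * R} with hcube
  set ext : Set (Edge 4 L) :=
    {ℓ | ∀ i : Fin n, ¬ ∀ ν : Fin 4, (ℓ.1 ν - c i ν + R).val ≤ 2 * R} with hext
  set Λ : Fin n → Finset (Edge 4 L) := fun i => (Set.toFinite (cube i)).toFinset with hΛ
  have hΛc : ∀ i, (↑(Λ i) : Set (Edge 4 L)) = cube i := fun i => Set.Finite.coe_toFinset _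
  have hΛcompl : ∀ i, (↑(Λ i) : Set (Edge 4 L))ᶜ =
      {ℓ | ¬ ∀ ν : Fin 4, (ℓ.1 ν - c i ν + R).val ≤ 2 * R} := fun i => by
    rw [hΛc]; rfl
  -- geometry: the cubes are disjoint and no plaquette meets two of them
  have hdisj : ∀ e i j, e ∈ cube i → e ∈ cube j → i = j := by
    intro e i j hi hj
    by_contra hij
    obtain ⟨ν, h1, h2⟩ := hsep i j hij
    rcases val_sub_le_or_of_adjacent hL (Or.inl rfl) (hi ν) (hj ν) with h | h <;> omega
  have huniq : ∀ (Λ' A : Finset (Edge 4 L)), A ∈ supp Λ' → ∀ e₀ ∈ A, ∀ e ∈ A, ∀ i j,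
      e₀ ∈ cube i → e ∈ cube j → i = j := by
    intro Λ' A hA e₀ he₀ e he i j hi hj
    obtain ⟨y, i', j', -, rfl⟩ := hstruct Λ' A hA
    by_contra hij
    obtain ⟨ν, h1, h2⟩ := hsep i j hij
    rcases not_separated_of_mem_plaquette hL he₀ he hi hj ν with h | h <;> omega
  have hext_sub : ∀ i, ext ⊆ (↑(Λ i) : Set (Edge 4 L))ᶜ := fun i ℓ hℓ hℓi => by
    rw [hΛc] at hℓi
    exact hℓ i hℓi
  have hcube_sub : ∀ i j, i ≠ j → cube i ⊆ (↑(Λ j) : Set (Edge 4 L))ᶜ := fun i j hij ℓ hℓ hℓj => by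
    rw [hΛc] at hℓj
    exact hij (hdisj ℓ i j hℓ hℓj)
  have hT : ∀ i, ∀ A ∈ supp (Λ i), (A ∩ Λ i).Nonempty →
      (↑A : Set (Edge 4 L)) ⊆ ↑(Λ i) ∪ ext := by
    intro i A hA hne e he
    obtain ⟨e₀, he₀⟩ := hne
    rw [Finset.mem_inter] at he₀
    have he₀c : e₀ ∈ cube i := by rw [← hΛc]; exact Finset.mem_coe.2 he₀.2
    by_cases h : ∃ j, e ∈ cube j
    · obtain ⟨j, hj⟩ := h
      obtain rfl := huniq (Λ i) A hA e₀ he₀.1 e he i j he₀c hj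
      left
      rw [hΛc]
      exact hj
    · right
      exact fun j hj => h ⟨j, hj⟩
  -- the local versions `g i = γ_{Λ i} φ i` of the conditional expectations
  choose M hM using hφb
  set g : Fin n → GaugeConfig 4 L G → ℝ :=
    fun i η => ∫ σ, φ i σ ∂(gibbsSpecOfPotential (haarProbability G) Φ supp β (Λ i) η) with hg
  have hloc : ∀ i, StronglyMeasurable[cylinderEvents ext] (g i) ∧
      g i =ᵐ[μ] μ[φ i | cylinderEvents (↑(Λ i) : Set (Edge 4 L))ᶜ] := fun i =>
    stronglyMeasurable_and_ae_eq_condExp_integral_gibbsSpecOfPotential (haarProbability G) hΦ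
      hΦb hsupp β hGibbs (Λ i) (hT i) (hφm i) (hM i)
      ((hφd i).mono (by rw [hΛc]; exact Set.subset_union_left))
  have hgb : ∀ i η, |g i η| ≤ M i := fun i η => by
    haveI := (isSpecification_gibbsSpecOfPotential (haarProbability G) hΦ hΦb hsupp β).isProbability
      (Λ i) η
    have := norm_integral_le_of_norm_le_const
      (μ := gibbsSpecOfPotential (haarProbability G) Φ supp β (Λ i) η) (f := φ i) (C := M i)
      (ae_of_all _ fun σ => by rw [Real.norm_eq_abs]; exact hM i σ)
    simpa only [probReal_univ, mul_one, Real.norm_eq_abs] using this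
  have hgi : ∀ i, Integrable (g i) μ := fun i =>
    Integrable.of_bound ((hloc i).1.mono cylinderEvents_le_pi).aestronglyMeasurable (M i)
      (ae_of_all _ fun η => by rw [Real.norm_eq_abs]; exact hgb i η)
  -- (ii), sharp form: `μ[φ i | ext] = g i`
  have h2 : ∀ i, μ[φ i | cylinderEvents ext] =ᵐ[μ] g i := fun i =>
    calc μ[φ i | cylinderEvents ext]
        =ᵐ[μ] μ[μ[φ i | cylinderEvents (↑(Λ i) : Set (Edge 4 L))ᶜ] | cylinderEvents ext] :=
          (condExp_condExp_of_le (cylinderEvents_mono (hext_sub i)) cylinderEvents_le_pi).symm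
      _ =ᵐ[μ] μ[g i | cylinderEvents ext] := condExp_congr_ae (hloc i).2.symm
      _ = g i := condExp_of_stronglyMeasurable cylinderEvents_le_pi (hloc i).1 (hgi i)
  refine ⟨?_, fun i => (h2 i).trans (by simpa only [hΛcompl] using (hloc i).2)⟩
  -- (i): peel off one cube at a time
  have hbdd : ∀ (J : Finset (Fin n)) U, |∏ i ∈ J, φ i U| ≤ ∏ i ∈ J, M i := fun J U => by
    rw [Finset.abs_prod]
    exact Finset.prod_le_prod (fun i _ => abs_nonneg _) fun i _ => hM i U
  have hmeas : ∀ J : Finset (Fin n), Measurable fun U => ∏ i ∈ J, φ i U := fun J =>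
    Finset.measurable_fun_prod J fun i _ => hφm i
  have hint : ∀ J : Finset (Fin n), Integrable (fun U => ∏ i ∈ J, φ i U) μ := fun J =>
    Integrable.of_bound (hmeas J).aestronglyMeasurable (∏ i ∈ J, M i)
      (ae_of_all _ fun U => by rw [Real.norm_eq_abs]; exact hbdd J U)
  have claim : ∀ J : Finset (Fin n),
      μ[(fun U => ∏ i ∈ J, φ i U) | cylinderEvents ext] =ᵐ[μ] fun U => ∏ i ∈ J, g i U := by
    intro J
    induction J using Finset.induction_on with
    | empty =>
      simp only [Finset.prod_empty]
      rw [condExp_const cylinderEvents_le_pi]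
    | insert j J hj ih =>
      have hprodφ : (fun U => ∏ i ∈ insert j J, φ i U) = φ j * fun U => ∏ i ∈ J, φ i U := by
        funext U; rw [Finset.prod_insert hj]; rfl
      have hprodg : (fun U => ∏ i ∈ insert j J, g i U) = g j * fun U => ∏ i ∈ J, g i U := by
        funext U; rw [Finset.prod_insert hj]; rfl
      rw [hprodφ, hprodg]
      -- `P = ∏_{i ∈ J} φ i` is measurable for the links off `Λ j` and bounded
      have hPm : StronglyMeasurable[cylinderEvents (↑(Λ j) : Set (Edge 4 L))ᶜ]
          (fun U => ∏ i ∈ J, φ i U) :=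
        Finset.stronglyMeasurable_fun_prod (m := cylinderEvents (↑(Λ j) : Set (Edge 4 L))ᶜ) J
          fun i hi => ((hφm i).measurable_cylinderEvents_of_dependsOn ((hφd i).mono
            (hcube_sub i j (fun h => hj (h ▸ hi))))).stronglyMeasurable
      have hφjint : Integrable (φ j) μ :=
        Integrable.of_bound (hφm j).aestronglyMeasurable (M j)
          (ae_of_all _ fun U => by rw [Real.norm_eq_abs]; exact hM j U)
      have hφPint : Integrable (φ j * fun U => ∏ i ∈ J, φ i U) μ :=
        Integrable.of_bound ((hφm j).mul (hmeas J)).aestronglyMeasurable (M j * ∏ i ∈ J, M i)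
          (ae_of_all _ fun U => by
            rw [Real.norm_eq_abs, Pi.mul_apply, abs_mul]
            exact mul_le_mul (hM j U) (hbdd J U) (abs_nonneg _) ((abs_nonneg _).trans (hM j U)))
      have hgPint : Integrable (g j * fun U => ∏ i ∈ J, φ i U) μ :=
        Integrable.of_bound (((hloc j).1.mono cylinderEvents_le_pi).measurable.mul
          (hmeas J)).aestronglyMeasurable (M j * ∏ i ∈ J, M i)
          (ae_of_all _ fun U => by
            rw [Real.norm_eq_abs, Pi.mul_apply, abs_mul]
            exact mul_le_mul (hgb j U) (hbdd J U) (abs_nonneg _) ((abs_nonneg _).trans (hgb j U)))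
      calc μ[φ j * fun U => ∏ i ∈ J, φ i U | cylinderEvents ext]
          =ᵐ[μ] μ[μ[φ j * fun U => ∏ i ∈ J, φ i U | cylinderEvents (↑(Λ j) : Set (Edge 4 L))ᶜ] |
              cylinderEvents ext] :=
            (condExp_condExp_of_le (cylinderEvents_mono (hext_sub j)) cylinderEvents_le_pi).symm
        _ =ᵐ[μ] μ[μ[φ j | cylinderEvents (↑(Λ j) : Set (Edge 4 L))ᶜ] * fun U => ∏ i ∈ J, φ i U |
              cylinderEvents ext] :=
            condExp_congr_ae (condExp_mul_of_stronglyMeasurable_right hPm hφPint hφjint)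
        _ =ᵐ[μ] μ[g j * fun U => ∏ i ∈ J, φ i U | cylinderEvents ext] :=
            condExp_congr_ae ((hloc j).2.symm.mul EventuallyEq.rfl)
        _ =ᵐ[μ] g j * μ[(fun U => ∏ i ∈ J, φ i U) | cylinderEvents ext] :=
            condExp_mul_of_stronglyMeasurable_left (hloc j).1 hgPint (hint J)
        _ =ᵐ[μ] g j * fun U => ∏ i ∈ J, g i U := EventuallyEq.rfl.mul ih
  have hall : ∀ᵐ U ∂μ, ∀ i, g i U = (μ[φ i | cylinderEvents ext]) U :=
    eventually_all.2 fun i => (h2 i).symm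
  exact (claim Finset.univ).trans (hall.mono fun U hU => Finset.prod_congr rfl fun i _ => hU i)

/-- **Stub C1 — conditional independence of separated cubes (DLR/Markov property of Wilson's
torus measure).**  On the torus of side `2S+1`, let `y₁,…,yₙ ∈ ℤ⁴` be centres whose images are
pairwise at torus sup-distance `≥ 2R+2` in some coordinate, `2R+2 ≤ S`, and let `φᵢ` be bounded
measurable observables reading only the links based in the sup-cube of radius `R` around `yᵢ`.
Then, conditionally on the links based outside ALL the cubes, (i) `E[∏ᵢ φᵢ | ext] =
∏ᵢ E[φᵢ | ext]` a.e., and (ii) `E[φᵢ | ext] = E[φᵢ | extᵢ]` a.e., `extᵢ` = links based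
outside the `i`-th cube (no plaquette meets two cubes; the DLR kernel of a cube is a version of
the conditional expectation given its exterior and reads only the collar links —
`isGibbsMeasure_wilsonMeasure`, `stronglyMeasurable_and_ae_eq_condExp_integral_gibbsSpecOfPotential`,
tower property and pull-out). -/
theorem stub_condIndepCubes (r : LatticeRep G) (β : ℝ) (S R : ℕ) (hRS : 2 * R + 2 ≤ S) {n : ℕ}
    (y : Fin n → Site 4)
    (hsep : ∀ i j, i ≠ j → ∃ ν : Fin 4,
      2 * R + 2 ≤ ((((y i ν : ℤ) : ZMod (2 * S + 1)) - ((y j ν : ℤ) : ZMod (2 * S + 1))).val) ∧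
      2 * R + 2 ≤ ((((y j ν : ℤ) : ZMod (2 * S + 1)) - ((y i ν : ℤ) : ZMod (2 * S + 1))).val))
    (φ : Fin n → GaugeConfig 4 (2 * S + 1) G → ℝ) (hφm : ∀ i, Measurable (φ i))
    (hφb : ∀ i, ∃ M : ℝ, ∀ U, |φ i U| ≤ M)
    (hφd : ∀ i, DependsOn (φ i) {ℓ : Edge 4 (2 * S + 1) |
      ∀ ν : Fin 4, (ℓ.1 ν - ((y i ν : ℤ) : ZMod (2 * S + 1)) + (R : ZMod (2 * S + 1))).val ≤ 2 * R}) :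
    (wilsonMeasure r.ρ β : Measure (GaugeConfig 4 (2 * S + 1) G))[(fun U => ∏ i, φ i U) |
        cylinderEvents {ℓ : Edge 4 (2 * S + 1) | ∀ i : Fin n,
          ¬ ∀ ν : Fin 4, (ℓ.1 ν - ((y i ν : ℤ) : ZMod (2 * S + 1)) + (R : ZMod (2 * S + 1))).val ≤ 2 * R}]
      =ᵐ[(wilsonMeasure r.ρ β : Measure (GaugeConfig 4 (2 * S + 1) G))]
      (fun U => ∏ i, ((wilsonMeasure r.ρ β : Measure (GaugeConfig 4 (2 * S + 1) G))[φ i |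
        cylinderEvents {ℓ : Edge 4 (2 * S + 1) | ∀ i : Fin n,
          ¬ ∀ ν : Fin 4, (ℓ.1 ν - ((y i ν : ℤ) : ZMod (2 * S + 1)) + (R : ZMod (2 * S + 1))).val ≤ 2 * R}])
            U) ∧
    ∀ i : Fin n,
      (wilsonMeasure r.ρ β : Measure (GaugeConfig 4 (2 * S + 1) G))[φ i |
        cylinderEvents {ℓ : Edge 4 (2 * S + 1) | ∀ i : Fin n,
          ¬ ∀ ν : Fin 4, (ℓ.1 ν - ((y i ν : ℤ) : ZMod (2 * S + 1)) + (R : ZMod (2 * S + 1))).val ≤ 2 * R}]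
      =ᵐ[(wilsonMeasure r.ρ β : Measure (GaugeConfig 4 (2 * S + 1) G))]
      (wilsonMeasure r.ρ β : Measure (GaugeConfig 4 (2 * S + 1) G))[φ i |
        cylinderEvents {ℓ : Edge 4 (2 * S + 1) |
          ¬ ∀ ν : Fin 4, (ℓ.1 ν - ((y i ν : ℤ) : ZMod (2 * S + 1)) + (R : ZMod (2 * S + 1))).val ≤ 2 * R}] := by
  exact condExp_prod_cubes_wilsonMeasure r β R (by omega)
    (fun i ν => ((y i ν : ℤ) : ZMod (2 * S + 1))) hsep φ hφm hφb hφd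

end Summit.QuantumFields.YangMills.Theorems.TemperedCurvatureMoments.Sketch

end
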